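import Summits.AtomisticToContinuum.HydrodynamicLimit.Theses.AnosovDiceHopf
import Literature.Dynamics.Hyperbolic.AnosovDiePairPlaque

/-!
# Refutation of `AnosovDiceHopf.DiceConstruction` (item stmt-AtomisticToContinuum-14288)

`DiceConstruction : ∃ D : AnosovDie, D.HasAbsolutelyContinuousLaw ∧ D.IsPairPlaqueSubmersive` is
FALSE as typed: the Literature predicate `AnosovDie.IsPairPlaqueSubmersive` ("for `m ⊗ m`-a.e.
`(θ, θ′)` and EVERY `p` in the open Lambert disc the differential at `0` of
`(r, r′) ↦ F(W θ r, W θ′ r′)(p)` is onto") is unsatisfiable for EVERY Anosov die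
(`Literature.Dynamics.Hyperbolic.AnosovDie.not_isPairPlaqueSubmersive`, proved in
`Literature/Dynamics/Hyperbolic/AnosovDiePairPlaque.lean`).  Obstruction: for fixed `(θ, θ′)`,
`A_r := F(W θ r, θ′)` is a smooth family of Lebesgue-preserving bijections of the plane equal to the
identity off the open unit disc; the velocity `Y := ∂_r (A_r ∘ A_0⁻¹)|_{r=0}` is a `C¹`
divergence-free field vanishing off the disc, hence (stream function, interior extremum) has a zero
`q*` INSIDE the disc; at `p₀ := A_0⁻¹ q*` the `r`-partial of the pair-plaque map vanishes, so the
differential has rank ≤ 1 — for every `(θ, θ′)`, while `m ⊗ m ≠ 0`.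

The refuted decl was then replaced in the route by `DiceConstructionAE` (a.e. `p`); it is re-created
privately below, so the theorem's (append-only) statement is unchanged and nothing depends on the
retired route name.
-/

/-- PRIVATE re-creation (route namespace stays free; a refuted statement, NOT a cited fact) of the
route decl `…Theses.AnosovDiceHopf.DiceConstruction`, stmt-AtomisticToContinuum-14288, which the
planner REPLACED by `DiceConstructionAE` (stmt-13994) after the refutation below, so the name left
`Theses/AnosovDiceHopf.lean` (full-build breakage 2026-08-16, `Unknown identifier`): the item's
recorded signature verbatim, so that the append-only refuting theorem keeps elaborating. -/
private def Summit.AtomisticToContinuum.HydrodynamicLimit.Theses.AnosovDiceHopf.DiceConstruction :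
    Prop :=
  ∃ D : Literature.Dynamics.Hyperbolic.AnosovDie, D.HasAbsolutelyContinuousLaw ∧ D.IsPairPlaqueSubmersive

namespace Summit.AtomisticToContinuum.HydrodynamicLimit.Theorems

/-- Refutes `AnosovDiceHopf.DiceConstruction` [refuted-misstated]: no Anosov die is pair-plaque
submersive in the typed sense (submersion for a.e. `(θ, θ′)` and EVERY `p` in the open disc),
because for every `(θ, θ′)` the divergence-free velocity field of the area-preserving family
`r ↦ F(W θ r, θ′) ∘ F(θ, θ′)⁻¹` vanishes at an interior point of the disc, where the differential of
the pair-plaque map has rank ≤ 1 (`AnosovDie.not_isPairPlaqueSubmersive`).  Witness: any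
`D : AnosovDie`, any `(θ, θ′)`, `p₀ = F(θ,θ′)⁻¹ q*` with `q*` an interior critical point of the
stream function.  Repaired statement C′ (believed true; the witness misses it, zeros of a generic
Hamiltonian field being isolated): ask submersivity for a.e. `p`, e.g.
`∃ D : AnosovDie, D.HasAbsolutelyContinuousLaw ∧ ∀ᵐ q ∂(D.m.prod D.m), ∀ᵐ p ∂(MeasureTheory.volume.restrict
(Metric.ball (0 : EuclideanSpace ℝ (Fin 2)) 1)), Function.Surjective (fderiv ℝ (D.pairPlaqueMap q.1 q.2 p) 0)`
(better: repair the Literature predicate `IsPairPlaqueSubmersive`, whose consumers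
`RotorGasMacroErgodic` / `RotorGasEulerLimit` are vacuous as typed). [folklore] -/
theorem AnosovDiceHopfDiceConstruction_refuted :
    ¬ Summit.AtomisticToContinuum.HydrodynamicLimit.Theses.AnosovDiceHopf.DiceConstruction :=
  fun ⟨D, _, h⟩ => Literature.Dynamics.Hyperbolic.AnosovDie.not_isPairPlaqueSubmersive D h

end Summit.AtomisticToContinuum.HydrodynamicLimit.Theorems
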